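import Mathlib
import Literature.Analysis.FluidPDE.ClassicalSuitable
import Literature.Analysis.FluidPDE.SuitableWeakCongr
import Literature.Analysis.FluidPDE.LocalTypeICongr
import Literature.Analysis.FluidPDE.LocalTypeIReverseTools
import Literature.Analysis.FluidPDE.SpaceTimeRescaling
import Literature.Analysis.FluidPDE.SelfSimilar
import Literature.Analysis.FluidPDE.TypeIRateOseenMildRepresentative
import Literature.Analysis.FluidPDE.LocalTypeIBlowup.SingularVertexZoom
import Summits.NavierStokesRegularity.NavierStokesRegularity.Theorems.DulacContractionSmoothRepresentativePressure
import Summits.NavierStokesRegularity.NavierStokesRegularity.Theorems.AdaptedFrequencyTangentFlowTransferAncientPressure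
import Summits.NavierStokesRegularity.NavierStokesRegularity.Theses.DulacContraction
import HarnessLib


/-!
# `DulacContraction.SmoothRepresentative` (item stmt-NavierStokesRegularity-8562), PROVED

**Statement.** A profile `(u, p, G)` of the Albritton–Barker class `𝒦_C` — a suitable weak
solution of the unit-viscosity Navier–Stokes system on the backward slab `ℝ³ × ℝ₋` with weak
spatial gradient `G`, `𝐈(ℝ³ × ℝ₋) < ∞` and the Type-I time rate `‖u(t,x)‖ ≤ C/√(−t)` — admits a
representative `(u', p', G')` in `𝒦_C` with the SAME `C` which is a CLASSICAL solution on `(−∞, 0)`,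
`u' = u` a.e. on the slab, and such that the backward singularity of the origin and the uniform
recurrence clause of route DulacContraction transfer from `u` to `u'`.

PROOF (glue of tree theorems; every input kernel-checked).
1. `exists_oseenMild_repr_of_typeIBound_lt_top` (KNSS 2009, Lemma 3.1, the parasitic drift being
   killed by the `A`-part of `𝐈`) gives a continuous, weakly divergence-free, Oseen-mild
   representative `v = u` a.e. with the rate `C`; `LocalTypeIBlowup.isTypeIAncientMild_of_continuous_oseenMild_rate`
   (KNSS 2009, Prop. 4.1) puts it in `IsTypeIAncientMild C` (jointly smooth);
   `exists_isClassicalNSSolutionOn_Iio_of_isTypeIAncientMild` (Fabes–Jones–Rivière; window pressures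
   normalised at the origin patch) gives ONE smooth pressure `q` with `(v, q)` classical on `(−∞, 0)`.
2. `(v, q)` is suitable on the slab (`isSuitableWeakSolutionOn_of_contDiffOn`, CKN (2.5) with
   equality); `G` is still a weak gradient of `v` (`HasWeakSpatialGradientOn.congr_ae`).
3. `𝐈(v, q, G) = 𝐈(u, p, G)` (`typeIBound_classical_eq`): `A`, `C` see the velocity a.e., `E` sees
   `G`, and `D` does not distinguish `q` from `p` — both are pressures of the one velocity `v`
   (`(v, p)` suitable by `IsSuitableWeakSolutionOn.congr_ae`), so on every window they differ by a
   measurable function of time (`exists_gauge_of_distributional_of_classical`: subtract the two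
   distributional momentum identities and apply the tree's
   `exists_measurable_gauge_of_forall_integral_mul_divergence_eq_zero`, Rusin–Šverák 2011 §2), which
   the mean-free `D` ignores (`cknDOsc_sub_timeFun'`, `cknDOsc_congr_ae_slices`).
4. The singular origin transfers by `IsBackwardSingularPoint.congr_ae`; the recurrence clause by
   `nsRescale_sub_congr_ae` (the parabolic dilation is quasi-measure-preserving and the slice
   `t = 0` is null).

HONEST FRAMING: interior-regularity bookkeeping for HYPOTHETICAL Type-I profiles of the class `𝒦_C`;
no such profile is asserted to exist and nothing here bears on the regularity problem itself.

References: G. Koch, N. Nadirashvili, G. Seregin, V. Šverák, Acta Math. 203 (2009), Lemma 3.1,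
Prop. 4.1; D. Albritton, T. Barker, arXiv:1811.00502, §1, §3; W. Rusin, V. Šverák, J. Funct. Anal.
260 (2011), §2; E. Fabes, B. Jones, N. Rivière, ARMA 45 (1972), Thm. 2.1.
-/

noncomputable section

set_option linter.dupNamespace false

namespace Summit.NavierStokesRegularity.NavierStokesRegularity.Theorems

open MeasureTheory TopologicalSpace Set Function Filter Metric
open Literature.Analysis.FluidPDE
open scoped ENNReal NNReal RealInnerProductSpace Laplacian

namespace SmoothRepresentative

/-! ### Transfer of the recurrence clause along the a.e. equality -/

/-- **Rescaled differences agree a.e. on compact sets below `t = 0`.** If `u = v` a.e. on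
`ℝ³ × ℝ₋` then, for `c > 0` and a measurable `K ⊆ ℝ³ × {t ≤ 0}`, the fields
`z ↦ c v(c² z.1, c z.2) − v z` and `z ↦ c u(c² z.1, c z.2) − u z` agree a.e. on `K` (the parabolic
dilation is quasi-measure-preserving, `quasiMeasurePreserving_stAffine`, and the slice `t = 0` is
Lebesgue-null). [folklore] -/
theorem nsRescale_sub_congr_ae
    {u v : ℝ → EuclideanSpace ℝ (Fin 3) → EuclideanSpace ℝ (Fin 3)}
    (hae : ∀ᵐ w ∂(volume.restrict (Iio (0 : ℝ) ×ˢ (univ : Set (EuclideanSpace ℝ (Fin 3))))),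
      uncurry u w = uncurry v w)
    {c : ℝ} (hc : 0 < c) {K : Set (ℝ × EuclideanSpace ℝ (Fin 3))} (hKm : MeasurableSet K)
    (hK : K ⊆ Iic (0 : ℝ) ×ˢ (univ : Set (EuclideanSpace ℝ (Fin 3)))) :
    (fun z : ℝ × EuclideanSpace ℝ (Fin 3) => nsRescale c v z.1 z.2 - v z.1 z.2)
      =ᵐ[volume.restrict K]
      (fun z : ℝ × EuclideanSpace ℝ (Fin 3) => nsRescale c u z.1 z.2 - u z.1 z.2) := by
  have h1 : ∀ᵐ w ∂(volume : Measure (ℝ × EuclideanSpace ℝ (Fin 3))),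
      w ∈ Iio (0 : ℝ) ×ˢ (univ : Set (EuclideanSpace ℝ (Fin 3))) → uncurry u w = uncurry v w :=
    (ae_restrict_iff' (measurableSet_Iio.prod MeasurableSet.univ)).1 hae
  have hΦ : Measure.QuasiMeasurePreserving (stAffine (c ^ 2) c 0 (0 : EuclideanSpace ℝ (Fin 3)))
      volume volume :=
    quasiMeasurePreserving_stAffine (by positivity) hc 0 0
  have h2 := hΦ.ae h1
  -- the slice `t = 0` is null
  have hnull : (volume : Measure (ℝ × EuclideanSpace ℝ (Fin 3)))
      (({0} : Set ℝ) ×ˢ (univ : Set (EuclideanSpace ℝ (Fin 3)))) = 0 := by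
    rw [Measure.volume_eq_prod, Measure.prod_prod, Real.volume_singleton, zero_mul]
  have h3 : ∀ᵐ w ∂(volume : Measure (ℝ × EuclideanSpace ℝ (Fin 3))),
      w ∉ ({0} : Set ℝ) ×ˢ (univ : Set (EuclideanSpace ℝ (Fin 3))) :=
    measure_eq_zero_iff_ae_notMem.1 hnull
  filter_upwards [ae_restrict_mem hKm, ae_restrict_of_ae h1, ae_restrict_of_ae h2,
    ae_restrict_of_ae h3] with w hwK hw1 hw2 hw3
  have hw0 : w.1 < 0 := by
    rcases eq_or_lt_of_le (mem_Iic.1 (hK hwK).1) with h | h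
    · exact absurd ⟨h, mem_univ _⟩ hw3
    · exact h
  have e1 : u w.1 w.2 = v w.1 w.2 := hw1 ⟨hw0, mem_univ _⟩
  have hΦw : stAffine (c ^ 2) c 0 (0 : EuclideanSpace ℝ (Fin 3)) w ∈
      Iio (0 : ℝ) ×ˢ (univ : Set (EuclideanSpace ℝ (Fin 3))) := by
    refine ⟨?_, mem_univ _⟩
    show (0 : ℝ) + c ^ 2 * w.1 < 0
    nlinarith [pow_pos hc 2]
  have e2 : u (c ^ 2 * w.1) (c • w.2) = v (c ^ 2 * w.1) (c • w.2) := by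
    have h := hw2 hΦw
    simpa [stAffine, uncurry] using h
  simp only [nsRescale_apply, e1, e2]

end SmoothRepresentative

open SmoothRepresentative in
/-- **Item stmt-NavierStokesRegularity-8562** (`DulacContraction.SmoothRepresentative`): every
profile `(u, p, G)` of `𝒦_C` (suitable on the backward slab, weak gradient, `𝐈 < ∞`, Type-I time
rate `C`) has a representative `(u', p', G')` in `𝒦_C` with the same `C`, classical on `(−∞, 0)`,
`u' = u` a.e. on the slab, with the transfers of the singular origin and of the uniform recurrence
clause. Here `u'` is the continuous Oseen-mild representative (KNSS Lemma 3.1 / Prop. 4.1), `p'`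
its classical pressure on `(−∞, 0)`, `G' = G`; `𝐈` is unchanged (`typeIBound_classical_eq`).
[cite: KochNadirashviliSereginSverak2009, Lemma 3.1 and Prop. 4.1; AlbrittonBarker2019, §1 and §3; FabesJonesRiviere1972, Thm. 2.1] -/
theorem dulacContraction_smoothRepresentative_proof :
    Summit.NavierStokesRegularity.NavierStokesRegularity.Theses.DulacContraction.SmoothRepresentative := by
  unfold Summit.NavierStokesRegularity.NavierStokesRegularity.Theses.DulacContraction.SmoothRepresentative
  intro u p G C hsw hwg hI hC
  -- ## (1) the continuous Oseen-mild representative, its class, one classical pressure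
  obtain ⟨v, hae, hvc, hvdiv, hvmild, hvrate⟩ := exists_oseenMild_repr_of_typeIBound_lt_top hsw hC hI
  have hv : IsTypeIAncientMild C v :=
    LocalTypeIBlowup.isTypeIAncientMild_of_continuous_oseenMild_rate hvc hvdiv hvmild hvrate
  obtain ⟨q, hcl⟩ := exists_isClassicalNSSolutionOn_Iio_of_isTypeIAncientMild hv
  -- ## (2) transfer of the suitability and of the weak gradient; the smooth pair is suitable
  have hslab : ((slab (EuclideanSpace ℝ (Fin 3)) (Iio 0) isOpen_Iio :
      Opens (ℝ × EuclideanSpace ℝ (Fin 3))) : Set (ℝ × EuclideanSpace ℝ (Fin 3))) =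
      Iio (0 : ℝ) ×ˢ (univ : Set (EuclideanSpace ℝ (Fin 3))) := coe_slab _ _
  have hae' : ∀ᵐ z ∂(volume.restrict ((slab (EuclideanSpace ℝ (Fin 3)) (Iio 0) isOpen_Iio :
      Opens (ℝ × EuclideanSpace ℝ (Fin 3))) : Set (ℝ × EuclideanSpace ℝ (Fin 3)))),
      uncurry u z = uncurry v z := by
    rw [hslab]; exact hae
  have hsw_v : IsSuitableWeakSolutionOn (slab (EuclideanSpace ℝ (Fin 3)) (Iio 0) isOpen_Iio) 1 0 v p :=
    hsw.congr_ae hae' (ae_of_all _ fun _ => rfl)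
  have hwg_v : HasWeakSpatialGradientOn (slab (EuclideanSpace ℝ (Fin 3)) (Iio 0) isOpen_Iio) v G :=
    hwg.congr_ae hae'
  have hsw_vq : IsSuitableWeakSolutionOn
      (slab (EuclideanSpace ℝ (Fin 3)) (Iio 0) isOpen_Iio) 1 0 v q := by
    refine isSuitableWeakSolutionOn_of_contDiffOn isOpen_Iio hslab.le
      (hcl.smooth_velocity.of_le (by norm_cast)) (hcl.smooth_pressure.of_le (by norm_cast))
      continuousOn_const (fun t ht x => ?_) hcl.divFree
    have h := hcl.momentum t ht x
    rwa [timeDerivWithin_of_mem_interior (by rwa [isOpen_Iio.interior_eq]) x] at h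
  -- ## (3) `𝐈` is unchanged
  have hIeq : typeIBound (Iio (0 : ℝ) ×ˢ univ) v q G = typeIBound (Iio (0 : ℝ) ×ˢ univ) u p G :=
    typeIBound_classical_eq hae hsw_v hcl
  have hIv : typeIBound (Iio (0 : ℝ) ×ˢ univ) v q G < ⊤ := by rw [hIeq]; exact hI
  refine ⟨v, q, G, ⟨hsw_vq, hwg_v, hIv, hv.hasTypeITimeDecay⟩, hcl, ?_, ?_, ?_⟩
  · -- `u' = u` a.e. on the slab
    filter_upwards [hae] with z hz
    exact hz.symm
  · -- ## (4a) the singular origin transfers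
    exact fun hsing => hsing.congr_ae (S := Iio (0 : ℝ) ×ˢ (univ : Set (EuclideanSpace ℝ (Fin 3))))
      (fun r _ => parabolicCylinder_subset_lowerHalf le_rfl r) hae
  · -- ## (4b) the recurrence clause transfers
    intro hrec ε hε K hK hKsub
    obtain ⟨L, hL, hLa⟩ := hrec ε hε K hK hKsub
    refine ⟨L, hL, fun a => ?_⟩
    obtain ⟨σ, hσ, hle⟩ := hLa a
    refine ⟨σ, hσ, ?_⟩
    rw [eLpNorm_congr_ae (nsRescale_sub_congr_ae hae (Real.exp_pos σ) hK.measurableSet hKsub)]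
    exact hle


end Summit.NavierStokesRegularity.NavierStokesRegularity.Theorems

end
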